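import Mathlib.LinearAlgebra.Prod
import Mathlib.LinearAlgebra.Pi
import Mathlib.LinearAlgebra.Finsupp.LinearCombination
import Mathlib.LinearAlgebra.Span.Basic
import Mathlib.Algebra.BigOperators.Fin
import Mathlib.Data.Fintype.Powerset
import Mathlib.Tactic.Abel
import HarnessLib

/-!
# Gao–Ullmo 2025, Proposition 4.5 / Proposition 5.1: the kernel of the reflex norm on characters

Z. Gao, E. Ullmo, *Hodge cycles and quadratic relations between holomorphic periods on CM abelian varieties*,
J. Inst. Math. Jussieu **25** (2025), no. 1, 215–249, doi:10.1017/S1474748025101291 = arXiv:2411.12249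
[GaoUllmo2025], §4.2 and §5.  For a CM field `E` of degree `2g` "of Weyl type" with reflex field `E^*`
(`[E^* : ℚ] = 2^g`), the character lattices are `X^*(E^×) = ⊕_{j} ℤφ_j ⊕ ⊕_{j} ℤφ̄_j` (§2.3) and
`X^*((E^*)^×) = ℤ[{ε_I}_{I ⊆ {1,…,g}}]` (§4.2, eq. (4.5)); **Proposition 4.5** computes the map `rec^*` induced by the
reflex norm on characters, `ε_I ↦ Σ_{j ∉ I} φ_j + Σ_{j ∈ I} φ̄_j`, and **Proposition 5.1** describes its kernel:
"The kernel `N'` is generated by all the `ε_I + ε_J − ε_K − ε_L` with `I ∩ J = K ∩ L` and `I ∪ J = K ∪ L`."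

WHAT IS REPRODUCED.  The lattices `XStar g = ℤ[𝒫({1,…,g})]`, `XE g`, the map `recStar` DEFINED by the formula of
Proposition 4.5 (the proposition identifies the geometric reflex norm with this formula; only the formula enters
Proposition 5.1), `Nprime = ker rec^*`, the span `quadRel` of the quadrilateral relations, and Proposition 5.1
KERNEL-PROVED (`nprime_eq_quadRel`, for `g ≥ 1`; for `g = 0` it is false: `X^* = ℤε_∅`, `rec^* = 0`) along the
paper's lines: `N₁ ⊆ N'` (by Prop. 4.5), Lemma 5.3 (`M ∩ N' = 0` for `M = ℤε_∅ ⊕ ⊕_j ℤε_{{j}}`), and `X^* = M + N₁`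
(the induction behind Lemma 5.5: `ε_I = (ε_I + ε_∅ − ε_{I∖{i}} − ε_{{i}}) + ε_{I∖{i}} + ε_{{i}} − ε_∅`), which
replaces the paper's orthogonal-complement computation.  Purely combinatorial: no field enters.

LOCATORS as in `Literature.AlgebraicGeometry.GaoUllmo2025.CMHodgeModel`: "art. p. N" = article pagination, "chunk
p00MM Lk" = chunk/line of the held published text `corpus:paper:galaxy-pdf-4667137180`.

## References

* [GaoUllmo2025] Z. Gao, E. Ullmo, J. Inst. Math. Jussieu 25 (2025) 215–249 — §2.3 (art. p. 8), §4.2 eq. (4.5) and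
  Proposition 4.5 (art. p. 14–15), §5 Proposition 5.1, Lemma 5.3, Lemma 5.5 (art. p. 15–16).

## Provenance

Staged by the pub-hodgecm formalisation cell (lineage `pub-hodgecm-pohl`, successor of the cited-fact seat
`pub-hodgecm-cf-gaoullmo`) under the LEAN-IN-TREE rule; supersedes §§Kernel, API (second half), Prop51Proof of the
standalone package's `HodgeCM/Literature/GaoUllmo.lean` (gate run 24), namespace `HodgeCM.GaoUllmo` ↦
`Literature.AlgebraicGeometry.GaoUllmo2025`; the package's named `Prop` `Proposition51` + `Proposition51_holds` is
stated here directly as the theorem `nprime_eq_quadRel` (D-0026).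
-/

noncomputable section

namespace Literature.AlgebraicGeometry.GaoUllmo2025

/-! ### §4.2 / Proposition 4.5: the character lattices and `rec^*` -/

section Kernel

variable (g : ℕ)

/-- The characters of `(E^*)^×` for `E` of Weyl type of degree `2g` (§4.2, art. p. 14, chunks p0017 L1–L5 and
p0018 L1): "`X^*((E^*)^×) = ℤ[G/H']`" with `G/H'` identified via `η^*` (eq. (4.5)) with "`{ε_I H'}_{I ⊆ {1,…,g}}`",
"we denote by `ε_I` the basis of `X^*((E^*)^×)` corresponding to the coset `ε_I H'`": the free `ℤ`-module on the
subsets `I ⊆ {1, …, g}` (here `{1,…,g}` is `Fin g`). [cite: GaoUllmo2025, §4.2 eq. (4.5)] -/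
abbrev XStar : Type := Finset (Fin g) →₀ ℤ

/-- The basis vector `ε_I ∈ X^*((E^*)^×)`. [cite: GaoUllmo2025, §4.2 eq. (4.5)] -/
def eps (I : Finset (Fin g)) : XStar g := Finsupp.single I 1

/-- The characters of `E^×` (§2.3, art. p. 8, chunk p0008 L11, verbatim): "`X^*(E^×) = ⊕_{φ ∈ Φ} ℤφ ⊕ ⊕_{φ ∈ Φ} ℤφ̄`",
`Φ = {φ₁,…,φ_g}`: the free `ℤ`-module on the `2g` symbols `φ_j` (coded `(j, false)`) and `φ̄_j` (coded `(j, true)`).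
[cite: GaoUllmo2025, §2.3] -/
abbrev XE : Type := (Fin g × Bool) →₀ ℤ

/-- `φ_j ∈ X^*(E^×)`. [cite: GaoUllmo2025, §2.3] -/
def phi (j : Fin g) : XE g := Finsupp.single (j, false) 1

/-- `φ̄_j ∈ X^*(E^×)`. [cite: GaoUllmo2025, §2.3] -/
def phibar (j : Fin g) : XE g := Finsupp.single (j, true) 1

/-- **Proposition 4.5** (§4.2 end, art. p. 14–15, chunks p0017 L22–p0018 L5, verbatim): "The group homomorphism
induced by the reflex norm (2.4) (but with `E` and `E^*` switched)
`rec^* : X^*((E^*)^×) = ℤ[G/H'] ⟶ X^*(E^×) = ℤ[Hom(E, ℂ)]` is given by: for all `I ⊆ {1,…,g}`,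
`ε_I H' ↦ Σ_{j ∉ I} φ_j + Σ_{j ∈ I} φ̄_j`."  Taken here as the DEFINITION of `rec^*` on the character lattices (the
proposition identifies the geometric reflex norm with this formula; only the formula enters Proposition 5.1).
[cite: GaoUllmo2025, Prop. 4.5] -/
def recStar : XStar g →ₗ[ℤ] XE g :=
  Finsupp.linearCombination ℤ fun I : Finset (Fin g) =>
    (∑ j ∈ Finset.univ.filter (fun j => j ∉ I), phi g j) + ∑ j ∈ I, phibar g j

/-- `rec^*(ε_I) = Σ_{j ∉ I} φ_j + Σ_{j ∈ I} φ̄_j` (the formula of Proposition 4.5). [cite: GaoUllmo2025, Prop. 4.5] -/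
theorem recStar_eps (I : Finset (Fin g)) :
    recStar g (eps g I) = (∑ j ∈ Finset.univ.filter (fun j => j ∉ I), phi g j) + ∑ j ∈ I, phibar g j := by
  simp [recStar, eps]

/-- `N' := ker(rec^*)` (§5, art. p. 15, chunk p0018 L23: "`0 ⟶ N' → X^*((E^*)^×) —rec^*→ X^*(E^×)`").
[cite: GaoUllmo2025, §5] -/
def Nprime : Submodule ℤ (XStar g) := LinearMap.ker (recStar g)

/-- `N₁`: "the submodule of `N'` generated by all the `ε_I + ε_J − ε_K − ε_L` with `I ∩ J = K ∩ L` and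
`I ∪ J = K ∪ L`" (§5, art. p. 16, chunk p0019 L16, before Lemma 5.5), as a submodule of `X^*((E^*)^×)`.
[cite: GaoUllmo2025, §5] -/
def quadRel : Submodule ℤ (XStar g) :=
  Submodule.span ℤ {x | ∃ I J K L : Finset (Fin g),
    I ∩ J = K ∩ L ∧ I ∪ J = K ∪ L ∧ x = eps g I + eps g J - eps g K - eps g L}

/-- The `φ_j`-coordinate of `rec^*(ε_I)` is `1` if `j ∉ I` and `0` otherwise; the `φ̄_j`-coordinate is `1` if `j ∈ I`
and `0` otherwise (Proposition 4.5 read coordinatewise). [cite: GaoUllmo2025, Prop. 4.5] -/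
theorem recStar_eps_apply (I : Finset (Fin g)) (j : Fin g) (b : Bool) :
    recStar g (eps g I) (j, b) = if (j ∈ I ↔ b) then 1 else 0 := by
  rw [recStar_eps, Finsupp.add_apply, Finsupp.coe_finsetSum, Finsupp.coe_finsetSum, Finset.sum_apply,
    Finset.sum_apply]
  simp only [phi, phibar, Finsupp.single_apply, Prod.mk.injEq]
  cases b <;> simp [Finset.sum_ite_eq', Finset.mem_filter]

/-- **Easy half of Proposition 5.1** ("By Proposition 4.5, each such `ε_I + ε_J − ε_K − ε_L` is in `N'`", chunk
p0019 L34): the quadrilateral relations lie in the kernel of `rec^*`. [cite: GaoUllmo2025, Prop. 5.1] -/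
theorem quadRel_le_Nprime : quadRel g ≤ Nprime g := by
  rw [quadRel, Submodule.span_le]
  rintro x ⟨I, J, K, L, h1, h2, rfl⟩
  simp only [Nprime, SetLike.mem_coe, LinearMap.mem_ker, map_sub, map_add]
  ext ⟨j, b⟩
  simp only [Finsupp.coe_sub, Finsupp.coe_add, Pi.sub_apply, Pi.add_apply, recStar_eps_apply, Finsupp.coe_zero,
    Pi.zero_apply]
  have hI : (j ∈ I ∧ j ∈ J) ↔ (j ∈ K ∧ j ∈ L) := by
    rw [← Finset.mem_inter, ← Finset.mem_inter, h1]
  have hU : (j ∈ I ∨ j ∈ J) ↔ (j ∈ K ∨ j ∈ L) := by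
    rw [← Finset.mem_union, ← Finset.mem_union, h2]
  by_cases hi : j ∈ I <;> by_cases hj : j ∈ J <;> by_cases hk : j ∈ K <;> by_cases hl : j ∈ L <;>
    cases b <;> simp_all

end Kernel

/-! ### Proof of Proposition 5.1 (Lemma 5.3 + the induction behind Lemma 5.5) -/

section Prop51Proof

variable (g : ℕ)

/-- `M = ℤε_∅ ⊕ ⊕_j ℤε_{{j}}` (Lemma 5.3, art. p. 16, chunk p0018 L45: "Let `M` be the `g+1`-dimensional submodule of
`X^*((E^*)^×)` …"), as the range of the parametrisation `(k₀, k) ↦ k₀ ε_∅ + Σ_j k_j ε_{{j}}`.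
[cite: GaoUllmo2025, Lemma 5.3] -/
def mkM : (ℤ × (Fin g → ℤ)) →ₗ[ℤ] XStar g :=
  (LinearMap.fst ℤ ℤ (Fin g → ℤ)).smulRight (eps g ∅) +
    ∑ j : Fin g, ((LinearMap.proj j).comp (LinearMap.snd ℤ ℤ (Fin g → ℤ))).smulRight (eps g {j})

/-- `mkM (k₀, k) = k₀ ε_∅ + Σ_j k_j ε_{{j}}`. [folklore] -/
theorem mkM_apply (k : ℤ × (Fin g → ℤ)) :
    mkM g k = k.1 • eps g ∅ + ∑ j : Fin g, k.2 j • eps g {j} := by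
  simp [mkM, LinearMap.sum_apply]

/-- The `φ̄_i`-coordinate of `rec^*(k₀ ε_∅ + Σ k_j ε_{{j}})` is `k_i`. [folklore] -/
theorem recStar_mkM_apply_true (k : ℤ × (Fin g → ℤ)) (i : Fin g) :
    recStar g (mkM g k) (i, true) = k.2 i := by
  rw [mkM_apply, map_add, map_smul, map_sum, Finsupp.add_apply, Finsupp.smul_apply, Finsupp.coe_finsetSum,
    Finset.sum_apply, recStar_eps_apply]
  simp only [Finset.notMem_empty, map_smul, Finsupp.smul_apply, recStar_eps_apply, Finset.mem_singleton,
    smul_eq_mul]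
  simp [Finset.sum_ite_eq]

/-- The `φ_i`-coordinate of `rec^*(k₀ ε_∅ + Σ k_j ε_{{j}})` is `k₀ + Σ_{j ≠ i} k_j`. [folklore] -/
theorem recStar_mkM_apply_false (k : ℤ × (Fin g → ℤ)) (i : Fin g) :
    recStar g (mkM g k) (i, false) = k.1 + ∑ j : Fin g, if i = j then 0 else k.2 j := by
  rw [mkM_apply, map_add, map_smul, map_sum, Finsupp.add_apply, Finsupp.smul_apply, Finsupp.coe_finsetSum,
    Finset.sum_apply, recStar_eps_apply]
  simp only [Finset.notMem_empty, map_smul, Finsupp.smul_apply, recStar_eps_apply, Finset.mem_singleton,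
    smul_eq_mul]
  simp only [false_iff, mul_one, mul_ite, mul_zero]
  congr 1
  refine Finset.sum_congr rfl fun j _ => ?_
  by_cases h : i = j <;> simp [h]

/-- **Lemma 5.3** (art. p. 16, chunk p0018 L45): `M ∩ N' = 0`, i.e. `rec^*` is injective on `M` (for `g ≥ 1`).
[cite: GaoUllmo2025, Lemma 5.3] -/
theorem mkM_eq_zero_of_recStar_eq_zero (hg : 0 < g) (k : ℤ × (Fin g → ℤ)) (h : recStar g (mkM g k) = 0) :
    k = 0 := by
  have h2 : k.2 = 0 := by
    funext i
    have := recStar_mkM_apply_true g k i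
    rw [h, Finsupp.zero_apply] at this
    exact this.symm
  have h1 : k.1 = 0 := by
    have := recStar_mkM_apply_false g k ⟨0, hg⟩
    rw [h, Finsupp.zero_apply, h2] at this
    simpa [eq_comm] using this
  exact Prod.ext h1 h2

/-- The induction behind Lemma 5.5 (art. p. 16): every `ε_I` lies in `M + N₁`, since
`ε_I = (ε_I + ε_∅ − ε_{I∖{i}} − ε_{{i}}) + ε_{I∖{i}} + ε_{{i}} − ε_∅` for `i ∈ I`. [cite: GaoUllmo2025, Lemma 5.5] -/
theorem eps_mem_range_mkM_sup_quadRel (I : Finset (Fin g)) :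
    eps g I ∈ LinearMap.range (mkM g) ⊔ quadRel g := by
  induction I using Finset.induction_on with
  | empty =>
    apply Submodule.mem_sup_left
    exact ⟨(1, 0), by simp [mkM_apply]⟩
  | insert i I hi ih =>
    have hsingle : eps g {i} ∈ LinearMap.range (mkM g) ⊔ quadRel g := by
      apply Submodule.mem_sup_left
      refine ⟨(0, Pi.single i 1), ?_⟩
      rw [mkM_apply]
      simp [Pi.single_apply, Finset.sum_ite_eq']
    have hempty : eps g ∅ ∈ LinearMap.range (mkM g) ⊔ quadRel g :=
      Submodule.mem_sup_left ⟨(1, 0), by simp [mkM_apply]⟩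
    have hquad : eps g (insert i I) + eps g ∅ - eps g I - eps g {i} ∈ LinearMap.range (mkM g) ⊔ quadRel g := by
      apply Submodule.mem_sup_right
      apply Submodule.subset_span
      refine ⟨insert i I, ∅, I, {i}, ?_, ?_, rfl⟩
      · rw [Finset.inter_empty, Finset.inter_singleton_of_notMem hi]
      · rw [Finset.union_empty, Finset.union_comm, ← Finset.insert_eq]
    have : eps g (insert i I) =
        (eps g (insert i I) + eps g ∅ - eps g I - eps g {i}) + eps g I + eps g {i} - eps g ∅ := by abel
    rw [this]
    exact Submodule.sub_mem _ (Submodule.add_mem _ (Submodule.add_mem _ hquad ih) hsingle) hempty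

/-- `X^*((E^*)^×) = M + N₁`. [cite: GaoUllmo2025, Lemma 5.5] -/
theorem top_le_range_mkM_sup_quadRel : (⊤ : Submodule ℤ (XStar g)) ≤ LinearMap.range (mkM g) ⊔ quadRel g := by
  intro x _
  induction x using Finsupp.induction_linear with
  | zero => exact Submodule.zero_mem _
  | add x y hx hy => exact Submodule.add_mem _ (hx Submodule.mem_top) (hy Submodule.mem_top)
  | single I b =>
    have : Finsupp.single I b = b • eps g I := by simp [eps]
    rw [this]
    exact Submodule.smul_mem _ b (eps_mem_range_mkM_sup_quadRel g I)

/-- **Gao–Ullmo, Proposition 5.1** (§5, art. p. 15, chunk p0018 L29; proof art. p. 16, chunk p0019 L34–L40),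
VERBATIM: "The kernel `N'` is generated by all the `ε_I + ε_J − ε_K − ε_L` with `I ∩ J = K ∩ L` and `I ∪ J = K ∪ L`."
Here `N' = ker(rec^*)` with `rec^*` given by the formula of Proposition 4.5, `I, J, K, L ⊆ {1,…,g}`, `g ≥ 1` (§4.1:
"`E` a CM field of degree `2g`"), and "generated" = equality of `ℤ`-submodules of `X^*((E^*)^×)`.  KERNEL-PROVED:
`X^* = M + N₁` (`top_le_range_mkM_sup_quadRel`), `N₁ ⊆ N'` (`quadRel_le_Nprime`) and `M ∩ N' = 0` (Lemma 5.3,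
`mkM_eq_zero_of_recStar_eq_zero`). [cite: GaoUllmo2025, Prop. 5.1] -/
theorem nprime_eq_quadRel (hg : 0 < g) : Nprime g = quadRel g := by
  refine le_antisymm ?_ (quadRel_le_Nprime g)
  intro x hx
  obtain ⟨y, hy, z, hz, hyz⟩ :=
    Submodule.mem_sup.mp (top_le_range_mkM_sup_quadRel g (Submodule.mem_top (x := x)))
  obtain ⟨k, rfl⟩ := LinearMap.mem_range.mp hy
  have hzN : recStar g z = 0 := LinearMap.mem_ker.mp (quadRel_le_Nprime g hz)
  have hx' : recStar g x = 0 := LinearMap.mem_ker.mp hx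
  have hk : recStar g (mkM g k) = 0 := by
    rw [← hyz, map_add, hzN, add_zero] at hx'
    exact hx'
  obtain rfl := mkM_eq_zero_of_recStar_eq_zero g hg k hk
  rw [map_zero, zero_add] at hyz
  rw [← hyz]
  exact hz

end Prop51Proof

end Literature.AlgebraicGeometry.GaoUllmo2025

end
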